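import Summits.QuantumFields.BalabanUV.Beta.WilsonJetReflection2Polar
import Summits.QuantumFields.BalabanUV.Beta.WilsonStencilReflection
import Summits.QuantumFields.BalabanUV.Beta.WilsonBiStencilWardEntry

/-!
# The polarised `(2,2)`-jet reflection law, entrywise with colour

HONEST FRAMING.  Discharging `BetaPertH` makes Balaban's ultraviolet stability UNCONDITIONAL — a real constructive-QFT
result; it is NOT the continuum limit and NOT the Clay problem.  This leaf is bookkeeping toward ONE letter-level identity
(`(W-LET-S₂)`) on the Wilson side of ONE binder (`hR`/`hW`) of the `(D1)` conjunct of `BetaPertH` (cell pub-balaban, β sub-cell,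
lane an3): finite algebra over an arbitrary finite abelian lattice, every normed real algebra, every tracial real-linear
functional; no estimate, no limit, nothing cited — every statement is kernel-proved here ([folklore] = standard finite algebra;
no published theorem is quoted and no manuscript under audit is used).
HONEST DEPENDENCY.  continuum YM on `T⁴` ⇐ `BetaPertH` ∧ nine spine estimates (0/9 proved); `BetaPertH` ⇐ (D1) ∧ (D4) ∧ CAP+tail.
This file discharges NOTHING of `BetaPertH` and moves no wall statement.

THE CHAIN.  `WilsonJetReflection2Polar.jet22_pull_polar` (the `(2,2)`-jet law under the axis reflection `pull σ e α`, polarised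
in the background) is read here IN COORDINATES, in the currency of `WilsonBiStencilWardEntry` (matrices on the leg space
`Λ × (C × D)`): the field is a coordinate field `W = field t v`, the two backgrounds are bond letters `Bᵢ = bondLetter uᵢ κᵢ Yᵢ`.
All letters that occur — `t a`, the conjugates `[Y₁, t a]`, `[Y₂, t a]`, and `Y₁, Y₂` themselves — are coordinates of ONE doubly
rotated family `T = rotFam (rotFam t Y₂ ![]) Y₁ ![Y₁, Y₂]` (`WilsonBiStencilWardFrame.rotFam`), so that every jet is a quadratic
form (`jet22_field_quadForm`, `jet21_field_eq_neg_quadForm`, `hess22_polar`): the reflected `(2,2)` block is the two-bond vertex at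
the REFLECTED bonds read through the reflected coordinates `pullv` (§1 `pullv_quadForm`), the two contact directions
`reflDir₁ W Bᵢ α` are the conjugated coordinate fields of the coordinates CUT to the bond `(uᵢ, α)` (`WilsonJetReflection2Polar` §5),
the second contact direction and the contact–contact kinetic term are explicit letter traces against the curl–curl matrix `curlCurl`
(§2).  §3: the law
`v ⬝ᵥ N v = 0` for one explicit matrix `N` (`jet22_pull_quadForm`), hence `N P Q + N Q P = 0` for all legs (`jet22_pull_entry_colour`).
-/

namespace Summit.QuantumFields.BalabanUV.Beta.WilsonJetReflection2Entry

open scoped BigOperators Matrix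
open Literature.MathematicalPhysics.QuantumFieldTheory.Balaban1983to89.Beta
open Literature.MathematicalPhysics.QuantumFieldTheory.Balaban1983to89.Beta.PlaquetteVertex
open Literature.MathematicalPhysics.QuantumFieldTheory.Balaban1983to89.Beta.PlaquetteVertex2 (jet22)
open Literature.MathematicalPhysics.QuantumFieldTheory.Balaban1983to89.Beta.PlaquetteStencil (wilsonVertex₁)
open Literature.MathematicalPhysics.QuantumFieldTheory.Balaban1983to89.Beta.PlaquetteVertex2Stencil (hess22 jet22_field_quadForm)
open Literature.MathematicalPhysics.QuantumFieldTheory.Balaban1983to89.Beta.WilsonVertex2Kron (wilsonVertex₂)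
open Literature.MathematicalPhysics.QuantumFieldTheory.Balaban1983to89.Beta.WilsonVertex2Sym (hess22_polar)
open Summit.QuantumFields.BalabanUV.Beta.WilsonJetReflection (pull)
open Summit.QuantumFields.BalabanUV.Beta.WilsonJetReflection2 (reflDir₁ reflDir₂)
open Summit.QuantumFields.BalabanUV.Beta.WilsonReflectionFrame (sgn rsite pullv rsite_rsite)
open Summit.QuantumFields.BalabanUV.Beta.WilsonStencilReflection (pull_field pull_bondLetter)
open Summit.QuantumFields.BalabanUV.Beta.WilsonStencilDivergence (curlCurl)
open Summit.QuantumFields.BalabanUV.Beta.WilsonBiStencilWardFrame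
open Summit.QuantumFields.BalabanUV.Beta.WilsonBiStencilWardEntry (wilsonVertexOp_bondLetter quadForm_emb₀_emb₀ quadForm_emb₀_emb₁
  quadForm_emb₁_emb₀ entry_add_entry_eq_zero_of_quadForm)
open Summit.QuantumFields.BalabanUV.Beta.WilsonJetReflection2Polar

/-! ## §1 Cut matrices and the reflected coordinates in quadratic forms -/

section Cuts

variable {Λ : Type*} [Fintype Λ] [DecidableEq Λ] {C : Type*} [Fintype C] {D : Type*} [Fintype D] [DecidableEq D]

/-- the form of a matrix supported on the legs of the bond `(u₁, γ₁)` (rows) and `(u₂, γ₂)` (columns) is a double colour sum.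
[folklore] -/
theorem quadForm_cut₂ (v : Λ × (C × D) → ℝ) (u₁ u₂ : Λ) (γ₁ γ₂ : D) (g : C → C → ℝ) :
    v ⬝ᵥ ((Matrix.of fun P Q : Λ × (C × D) =>
        if (P.1 = u₁ ∧ P.2.2 = γ₁) ∧ (Q.1 = u₂ ∧ Q.2.2 = γ₂) then g P.2.1 Q.2.1 else 0) *ᵥ v) =
      ∑ a, ∑ b, v (u₁, (a, γ₁)) * g a b * v (u₂, (b, γ₂)) := by
  have inner : ∀ P : Λ × (C × D), (∑ Q : Λ × (C × D),
      (if (P.1 = u₁ ∧ P.2.2 = γ₁) ∧ (Q.1 = u₂ ∧ Q.2.2 = γ₂) then g P.2.1 Q.2.1 else 0) * v Q) =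
        if P.1 = u₁ ∧ P.2.2 = γ₁ then ∑ b, g P.2.1 b * v (u₂, (b, γ₂)) else 0 := by
    intro P
    by_cases hP : P.1 = u₁ ∧ P.2.2 = γ₁
    · simp only [hP, true_and, if_true]
      exact sum_cut u₂ γ₂ (g P.2.1) v
    · simp only [hP, false_and, if_false, zero_mul, Finset.sum_const_zero]
  simp only [dotProduct, Matrix.mulVec, Matrix.of_apply, inner]
  rw [show (∑ P : Λ × (C × D), v P * (if P.1 = u₁ ∧ P.2.2 = γ₁ then ∑ b, g P.2.1 b * v (u₂, (b, γ₂)) else 0))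
      = ∑ P : Λ × (C × D), (if P.1 = u₁ ∧ P.2.2 = γ₁ then ∑ b, g P.2.1 b * v (u₂, (b, γ₂)) else 0) * v P from
      Finset.sum_congr rfl fun P _ => mul_comm _ _,
    sum_cut u₁ γ₁ (fun a => ∑ b, g a b * v (u₂, (b, γ₂))) v]
  simp only [Finset.sum_mul]
  refine Finset.sum_congr rfl fun a _ => Finset.sum_congr rfl fun b _ => ?_
  ring

/-- a matrix against coordinates cut to a bond (column side) is the cut matrix against the coordinates. [folklore] -/
theorem dotProduct_mulVec_cut (K : Matrix (Λ × (C × D)) (Λ × (C × D)) ℝ) (v w : Λ × (C × D) → ℝ) (u : Λ) (γ : D) (c : Prop)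
    [Decidable c] :
    v ⬝ᵥ (K *ᵥ fun Q => if Q.1 = u ∧ Q.2.2 = γ ∧ c then w Q else 0) =
      v ⬝ᵥ ((Matrix.of fun P Q : Λ × (C × D) => if Q.1 = u ∧ Q.2.2 = γ ∧ c then K P Q else 0) *ᵥ w) := by
  simp only [dotProduct, Matrix.mulVec, Matrix.of_apply, Finset.mul_sum, mul_ite, ite_mul, mul_zero, zero_mul]

/-- a matrix against coordinates cut to a bond (row side) is the cut matrix against the coordinates. [folklore] -/
theorem cut_dotProduct_mulVec (K : Matrix (Λ × (C × D)) (Λ × (C × D)) ℝ) (v w : Λ × (C × D) → ℝ) (u : Λ) (γ : D) (c : Prop)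
    [Decidable c] :
    (fun P => if P.1 = u ∧ P.2.2 = γ ∧ c then w P else 0) ⬝ᵥ (K *ᵥ v) =
      w ⬝ᵥ ((Matrix.of fun P Q : Λ × (C × D) => if P.1 = u ∧ P.2.2 = γ ∧ c then K P Q else 0) *ᵥ v) := by
  simp only [dotProduct, Matrix.mulVec, Matrix.of_apply, Finset.mul_sum, mul_ite, ite_mul, mul_zero, zero_mul]

omit [DecidableEq Λ] in
/-- **the form in the reflected coordinates** `pullv σ e α v` is the form in `v` of the matrix re-indexed by the reflected base
sites `rsite` and signed by `sgn α` on both legs (the re-indexing is an involution by `rsite_rsite`). [folklore] -/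
theorem pullv_quadForm [AddCommGroup Λ] {σ : Λ → Λ} {e : D → Λ} {α : D} (hσ : Function.Involutive σ)
    (h₂ : ∀ x, σ (x + e α) = σ x - e α) (A : Matrix (Λ × (C × D)) (Λ × (C × D)) ℝ) (v : Λ × (C × D) → ℝ) :
    pullv σ e α v ⬝ᵥ (A *ᵥ pullv σ e α v) =
      v ⬝ᵥ ((Matrix.of fun P Q : Λ × (C × D) =>
        sgn α P.2.2 * sgn α Q.2.2 * A (rsite σ e α P.2.2 P.1, P.2) (rsite σ e α Q.2.2 Q.1, Q.2)) *ᵥ v) := by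
  have hρ : Function.Involutive (fun P : Λ × (C × D) => (rsite σ e α P.2.2 P.1, P.2)) := fun P => by
    simp only [rsite_rsite hσ h₂, Prod.mk.eta]
  simp only [dotProduct, Matrix.mulVec, Matrix.of_apply, pullv]
  rw [← hρ.bijective.sum_comp]
  refine Finset.sum_congr rfl fun P _ => ?_
  rw [← hρ.bijective.sum_comp, Finset.mul_sum, Finset.mul_sum]
  refine Finset.sum_congr rfl fun Q _ => ?_
  simp only [rsite_rsite hσ h₂]
  ring

end Cuts

/-! ## §2 The polarised Hessian of two deltas and the two contact traces, as quadratic forms -/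

section Letters

variable {𝔸 : Type*} [NormedRing 𝔸] [NormedAlgebra ℝ 𝔸]
variable {Λ : Type*} [Fintype Λ] [DecidableEq Λ] [AddCommGroup Λ] {C : Type*} [Fintype C] {D : Type*} [Fintype D] [DecidableEq D]

/-- **the polarised `(2,2)` Hessian of two scaled deltas in a quadratic form**: the symmetrised two-bond vertex, scaled. [folklore] -/
theorem quadForm_hess22_polar_single {C' : Type*} [Fintype C'] [DecidableEq C'] (τ : 𝔸 →ₗ[ℝ] ℝ) (T : C' → 𝔸) (e : D → Λ)
    (U : Λ × (C' × D) → ℝ) (P Q : Λ × (C' × D)) (a b : ℝ) :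
    U ⬝ᵥ (hess22 τ T e (field T (Pi.single P a + Pi.single Q b)) *ᵥ U) - U ⬝ᵥ (hess22 τ T e (field T (Pi.single P a)) *ᵥ U)
        - U ⬝ᵥ (hess22 τ T e (field T (Pi.single Q b)) *ᵥ U) =
      a * b * (U ⬝ᵥ ((wilsonVertex₂ τ T e P Q + wilsonVertex₂ τ T e Q P) *ᵥ U)) := by
  rw [← dotProduct_sub, ← Matrix.sub_mulVec, ← dotProduct_sub, ← Matrix.sub_mulVec, hess22_polar]
  have hsum : (∑ p₁ : Λ × (C' × D), ∑ p₂ : Λ × (C' × D), ((Pi.single P a : Λ × (C' × D) → ℝ) p₁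
      * (Pi.single Q b : Λ × (C' × D) → ℝ) p₂) • (wilsonVertex₂ τ T e p₁ p₂ + wilsonVertex₂ τ T e p₂ p₁))
        = (a * b) • (wilsonVertex₂ τ T e P Q + wilsonVertex₂ τ T e Q P) := by
    rw [Finset.sum_eq_single P]
    · rw [Finset.sum_eq_single Q]
      · rw [Pi.single_eq_same, Pi.single_eq_same]
      · intro p₂ _ hp₂; rw [Pi.single_eq_of_ne hp₂, mul_zero, zero_smul]
      · intro h; exact absurd (Finset.mem_univ _) h
    · intro p₁ _ hp₁; exact Finset.sum_eq_zero fun p₂ _ => by rw [Pi.single_eq_of_ne hp₁, zero_mul, zero_smul]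
    · intro h; exact absurd (Finset.mem_univ _) h
  rw [hsum, Matrix.smul_mulVec, dotProduct_smul, smul_eq_mul]

/-- **the second-contact kinetic term in coordinates**: `Σ_P v_P·τ(t_{P.c}·[c]·DD(W_γ(u)))·curlCurl (P̄) (u,γ)`, with
`DD = ad Y₁ ad Y₂ + ad Y₂ ad Y₁` and `W = field t v`, is the form of the matrix supported on the columns of the bond `(u, γ)` with
entries `τ(t_a·DD(t_b))·curlCurl`. [folklore] -/
theorem kin₃_quadForm {e : D → Λ} (τ : 𝔸 →ₗ[ℝ] ℝ) (t : C → 𝔸) (Y₁ Y₂ : 𝔸) (v : Λ × (C × D) → ℝ) (u : Λ) (γ : D) (c : Prop)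
    [Decidable c] :
    (∑ P : Λ × (C × D), v P * (τ (t P.2.1 * (if c then
        Y₁ * (Y₂ * field t v u γ - field t v u γ * Y₂) - (Y₂ * field t v u γ - field t v u γ * Y₂) * Y₁
          + (Y₂ * (Y₁ * field t v u γ - field t v u γ * Y₁) - (Y₁ * field t v u γ - field t v u γ * Y₁) * Y₂) else 0))
        * curlCurl e (P.1, P.2.2) (u, γ))) =
      v ⬝ᵥ ((Matrix.of fun P Q : Λ × (C × D) => if Q.1 = u ∧ Q.2.2 = γ ∧ c then
        τ (t P.2.1 * (Y₁ * (Y₂ * t Q.2.1 - t Q.2.1 * Y₂) - (Y₂ * t Q.2.1 - t Q.2.1 * Y₂) * Y₁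
          + (Y₂ * (Y₁ * t Q.2.1 - t Q.2.1 * Y₁) - (Y₁ * t Q.2.1 - t Q.2.1 * Y₁) * Y₂))) * curlCurl e (P.1, P.2.2) (u, γ)
        else 0) *ᵥ v) := by
  by_cases hc : c
  · simp only [hc, if_true, and_true, dotProduct, Matrix.mulVec, Matrix.of_apply]
    refine Finset.sum_congr rfl fun P _ => ?_
    rw [sum_cut u γ (fun b => τ (t P.2.1 * (Y₁ * (Y₂ * t b - t b * Y₂) - (Y₂ * t b - t b * Y₂) * Y₁
      + (Y₂ * (Y₁ * t b - t b * Y₁) - (Y₁ * t b - t b * Y₁) * Y₂))) * curlCurl e (P.1, P.2.2) (u, γ)) v]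
    congr 1
    rw [show field t v u γ = ∑ b, v (u, (b, γ)) • t b from rfl]
    simp only [conj_sum]
    rw [← Finset.sum_add_distrib]
    simp only [← smul_add, Finset.mul_sum, mul_smul_comm, map_sum, map_smul, smul_eq_mul, Finset.sum_mul]
    refine Finset.sum_congr rfl fun b _ => ?_
    ring
  · simp [hc, dotProduct, Matrix.mulVec]

omit [AddCommGroup Λ] in
/-- **the contact–contact kinetic term in coordinates**: `τ([c₁]·ad_{Y₁} W_{γ₁}(u₁) · [c₂]·ad_{Y₂} W_{γ₂}(u₂))·r`, `W = field t v`,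
is the form of the matrix supported on (rows of `(u₁,γ₁)`) × (columns of `(u₂,γ₂)`) with entries `τ([Y₁,t_a]·[Y₂,t_b])·r`.
[folklore] -/
theorem kin₄_quadForm (τ : 𝔸 →ₗ[ℝ] ℝ) (t : C → 𝔸) (Y₁ Y₂ : 𝔸) (v : Λ × (C × D) → ℝ) (u₁ u₂ : Λ) (γ₁ γ₂ : D) (c₁ c₂ : Prop)
    [Decidable c₁] [Decidable c₂] (r : ℝ) :
    τ ((if c₁ then Y₁ * field t v u₁ γ₁ - field t v u₁ γ₁ * Y₁ else 0) * (if c₂ then Y₂ * field t v u₂ γ₂ - field t v u₂ γ₂ * Y₂ else 0))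
        * r =
      v ⬝ᵥ ((Matrix.of fun P Q : Λ × (C × D) => if (P.1 = u₁ ∧ P.2.2 = γ₁) ∧ (Q.1 = u₂ ∧ Q.2.2 = γ₂) ∧ (c₁ ∧ c₂) then
        τ ((Y₁ * t P.2.1 - t P.2.1 * Y₁) * (Y₂ * t Q.2.1 - t Q.2.1 * Y₂)) * r else 0) *ᵥ v) := by
  rw [ite_zero_mul_ite_zero]
  by_cases hc : c₁ ∧ c₂
  · rw [if_pos hc]
    obtain ⟨h1, h2⟩ := hc
    simp only [h1, h2, and_self, and_true]
    rw [quadForm_cut₂ v u₁ u₂ γ₁ γ₂ (fun a b => τ ((Y₁ * t a - t a * Y₁) * (Y₂ * t b - t b * Y₂)) * r),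
      show field t v u₁ γ₁ = ∑ a, v (u₁, (a, γ₁)) • t a from rfl, show field t v u₂ γ₂ = ∑ b, v (u₂, (b, γ₂)) • t b from rfl,
      conj_sum, conj_sum, Finset.sum_mul_sum]
    simp only [smul_mul_assoc, mul_smul_comm, smul_smul, map_sum, map_smul, smul_eq_mul, Finset.sum_mul]
    refine Finset.sum_congr rfl fun a _ => Finset.sum_congr rfl fun b _ => ?_
    ring
  · rw [if_neg hc, map_zero, zero_mul]
    simp [hc, dotProduct, Matrix.mulVec]

end Letters

/-! ## §3 The law as a quadratic form on the leg space, and entrywise -/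

section Main

variable {𝔸 : Type*} [NormedRing 𝔸] [NormedAlgebra ℝ 𝔸]
variable {Λ : Type*} [Fintype Λ] [DecidableEq Λ] [AddCommGroup Λ] {C : Type*} [Fintype C] [DecidableEq C]
  {D : Type*} [Fintype D] [DecidableEq D] {σ : Λ → Λ} {e : D → Λ} {α : D}

set_option synthInstance.maxSize 512 in
/-- **THE POLARISED `(2,2)`-JET REFLECTION LAW AS A QUADRATIC-FORM LAW.**  For every finite abelian lattice `Λ` with frame `e`,
site map `σ` reflecting the axis `α` (`hσ`, `h₁`, `h₂`), normed real algebra `𝔸` with tracial `τ`, letter family `t : C → 𝔸`,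
bond letters `Bᵢ = bondLetter uᵢ κᵢ Yᵢ` and fluctuation coordinates `v` (`W = field t v`), with the doubly rotated family
`T = rotFam (rotFam t Y₂ ![]) Y₁ ![Y₁, Y₂]` (letters `t a` at `inl (inl a)`, `[Y₂, t a]` at `inl (inr (inl a))`, `[Y₁, t a]` at
`inr (inl (inl a))`, `Y₁, Y₂` at `inr (inr 0), inr (inr 1)`): `v ⬝ᵥ N v = 0`, `N = 4 s₁s₂·Ĥ − 4·H + 4·(A₁ + A₂ + A₃ + A₄) − 2·K₃ − 4·K₄`,
where `H` is the symmetrised two-bond `(2,2)` vertex of the two background bonds, `Ĥ` the same at the REFLECTED bonds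
(`rsite`, signs `sᵢ = sgn α κᵢ`) re-indexed through the reflected legs, `A₁…A₄` the one-bond `(2,1)` vertices of one background bond between
the fluctuation and its conjugate by the OTHER letter, cut to the other bond on the axis, `K₃` (second contact direction) and `K₄`
(contact–contact) the explicit letter traces against `curlCurl`.  This is `jet22_pull_polar` at `W = field t v`, `Bᵢ = bondLetter uᵢ κᵢ Yᵢ`
read through §1–§2. [folklore] -/
theorem jet22_pull_quadForm (τ : 𝔸 →ₗ[ℝ] ℝ) (hτ : ∀ a b : 𝔸, τ (a * b) = τ (b * a)) (hσ : Function.Involutive σ)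
    (h₁ : ∀ x κ, κ ≠ α → σ (x + e κ) = σ x + e κ) (h₂ : ∀ x, σ (x + e α) = σ x - e α) (t : C → 𝔸) (Y₁ Y₂ : 𝔸)
    (u₁ u₂ : Λ) (κ₁ κ₂ : D) (T : (C ⊕ (C ⊕ Fin 0)) ⊕ ((C ⊕ (C ⊕ Fin 0)) ⊕ Fin 2) → 𝔸)
    (hT : T = rotFam (rotFam t Y₂ ![]) Y₁ ![Y₁, Y₂]) (v : Λ × (C × D) → ℝ) :
    v ⬝ᵥ (((4 * (sgn α κ₁ * sgn α κ₂)) • (Matrix.of fun P Q : Λ × (C × D) => sgn α P.2.2 * sgn α Q.2.2 *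
            (wilsonVertex₂ τ T e (rsite σ e α κ₁ u₁, (Sum.inr (Sum.inr 0), κ₁)) (rsite σ e α κ₂ u₂, (Sum.inr (Sum.inr 1), κ₂))
              + wilsonVertex₂ τ T e (rsite σ e α κ₂ u₂, (Sum.inr (Sum.inr 1), κ₂)) (rsite σ e α κ₁ u₁, (Sum.inr (Sum.inr 0), κ₁)))
            (rsite σ e α P.2.2 P.1, (Sum.inl (Sum.inl P.2.1), P.2.2)) (rsite σ e α Q.2.2 Q.1, (Sum.inl (Sum.inl Q.2.1), Q.2.2)))
        - (4 : ℝ) • (Matrix.of fun P Q : Λ × (C × D) =>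
            (wilsonVertex₂ τ T e (u₁, (Sum.inr (Sum.inr 0), κ₁)) (u₂, (Sum.inr (Sum.inr 1), κ₂))
              + wilsonVertex₂ τ T e (u₂, (Sum.inr (Sum.inr 1), κ₂)) (u₁, (Sum.inr (Sum.inr 0), κ₁)))
            (P.1, (Sum.inl (Sum.inl P.2.1), P.2.2)) (Q.1, (Sum.inl (Sum.inl Q.2.1), Q.2.2)))
        + (4 : ℝ) • ((Matrix.of fun P Q : Λ × (C × D) => if Q.1 = u₂ ∧ Q.2.2 = α ∧ α = κ₂ then
              wilsonVertex₁ e u₁ κ₁ (adM τ T Y₁) (P.1, (Sum.inl (Sum.inl P.2.1), P.2.2)) (Q.1, (Sum.inl (Sum.inr (Sum.inl Q.2.1)), Q.2.2))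
              else 0)
            + (Matrix.of fun P Q : Λ × (C × D) => if P.1 = u₂ ∧ P.2.2 = α ∧ α = κ₂ then
              wilsonVertex₁ e u₁ κ₁ (adM τ T Y₁) (P.1, (Sum.inl (Sum.inr (Sum.inl P.2.1)), P.2.2)) (Q.1, (Sum.inl (Sum.inl Q.2.1), Q.2.2))
              else 0)
            + (Matrix.of fun P Q : Λ × (C × D) => if Q.1 = u₁ ∧ Q.2.2 = α ∧ α = κ₁ then
              wilsonVertex₁ e u₂ κ₂ (adM τ T Y₂) (P.1, (Sum.inl (Sum.inl P.2.1), P.2.2)) (Q.1, (Sum.inr (Sum.inl (Sum.inl Q.2.1)), Q.2.2))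
              else 0)
            + (Matrix.of fun P Q : Λ × (C × D) => if P.1 = u₁ ∧ P.2.2 = α ∧ α = κ₁ then
              wilsonVertex₁ e u₂ κ₂ (adM τ T Y₂) (P.1, (Sum.inr (Sum.inl (Sum.inl P.2.1)), P.2.2)) (Q.1, (Sum.inl (Sum.inl Q.2.1), Q.2.2))
              else 0))
        - (2 : ℝ) • (Matrix.of fun P Q : Λ × (C × D) => if Q.1 = u₁ ∧ Q.2.2 = α ∧ (u₁ = u₂ ∧ α = κ₁ ∧ α = κ₂) then
            τ (t P.2.1 * (Y₁ * (Y₂ * t Q.2.1 - t Q.2.1 * Y₂) - (Y₂ * t Q.2.1 - t Q.2.1 * Y₂) * Y₁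
              + (Y₂ * (Y₁ * t Q.2.1 - t Q.2.1 * Y₁) - (Y₁ * t Q.2.1 - t Q.2.1 * Y₁) * Y₂))) * curlCurl e (P.1, P.2.2) (u₁, α)
            else 0)
        - (4 : ℝ) • (Matrix.of fun P Q : Λ × (C × D) =>
            if (P.1 = u₁ ∧ P.2.2 = α) ∧ (Q.1 = u₂ ∧ Q.2.2 = α) ∧ (α = κ₁ ∧ α = κ₂) then
              τ ((Y₁ * t P.2.1 - t P.2.1 * Y₁) * (Y₂ * t Q.2.1 - t Q.2.1 * Y₂)) * curlCurl e (u₁, α) (u₂, α) else 0)) *ᵥ v) = 0 := by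
  -- the backgrounds, the field, the reflected field and the two first contact directions as coordinate fields of `T`
  have hB₁ : bondLetter u₁ κ₁ Y₁ = field T (Pi.single (u₁, (Sum.inr (Sum.inr (0 : Fin 2)), κ₁)) (1 : ℝ)) := by
    rw [hT, field_single, one_smul]; rfl
  have hB₂ : bondLetter u₂ κ₂ Y₂ = field T (Pi.single (u₂, (Sum.inr (Sum.inr (1 : Fin 2)), κ₂)) (1 : ℝ)) := by
    rw [hT, field_single, one_smul]; rfl
  have hB₁' : bondLetter (rsite σ e α κ₁ u₁) κ₁ (sgn α κ₁ • Y₁)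
      = field T (Pi.single (rsite σ e α κ₁ u₁, (Sum.inr (Sum.inr (0 : Fin 2)), κ₁)) (sgn α κ₁)) := by
    rw [hT, field_single]; rfl
  have hB₂' : bondLetter (rsite σ e α κ₂ u₂) κ₂ (sgn α κ₂ • Y₂)
      = field T (Pi.single (rsite σ e α κ₂ u₂, (Sum.inr (Sum.inr (1 : Fin 2)), κ₂)) (sgn α κ₂)) := by
    rw [hT, field_single]; rfl
  have hW : field t v = field T (emb₀ (Fin 2) (emb₀ (Fin 0) v)) := by
    rw [hT, field_rotFam_emb₀, field_rotFam_emb₀]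
  have hW' : field t (pullv σ e α v) = field T (emb₀ (Fin 2) (emb₀ (Fin 0) (pullv σ e α v))) := by
    rw [hT, field_rotFam_emb₀, field_rotFam_emb₀]
  have hE₁ : bondLetter u₁ α (if α = κ₁ then Y₁ * field t v u₁ α - field t v u₁ α * Y₁ else 0)
      = field T (emb₁ (Fin 2) (emb₀ (Fin 0) fun P : Λ × (C × D) => if P.1 = u₁ ∧ P.2.2 = α ∧ α = κ₁ then v P else 0)) := by
    rw [← conj_field_cut t Y₁ v u₁ (α = κ₁), hT]
    funext x k
    rw [field_rotFam_emb₁, field_rotFam_emb₀]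
  have hE₂ : bondLetter u₂ α (if α = κ₂ then Y₂ * field t v u₂ α - field t v u₂ α * Y₂ else 0)
      = field T (emb₀ (Fin 2) (emb₁ (Fin 0) fun P : Λ × (C × D) => if P.1 = u₂ ∧ P.2.2 = α ∧ α = κ₂ then v P else 0)) := by
    rw [← conj_field_cut t Y₂ v u₂ (α = κ₂), hT, field_rotFam_emb₀]
    funext x k
    rw [field_rotFam_emb₁]
  -- (o) the unreflected `(2,2)` block
  have m0 : jet22 ℝ τ e (field t v) (bondLetter u₁ κ₁ Y₁ + bondLetter u₂ κ₂ Y₂) - jet22 ℝ τ e (field t v) (bondLetter u₁ κ₁ Y₁)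
      - jet22 ℝ τ e (field t v) (bondLetter u₂ κ₂ Y₂) =
      v ⬝ᵥ ((Matrix.of fun P Q : Λ × (C × D) =>
        (wilsonVertex₂ τ T e (u₁, (Sum.inr (Sum.inr 0), κ₁)) (u₂, (Sum.inr (Sum.inr 1), κ₂))
          + wilsonVertex₂ τ T e (u₂, (Sum.inr (Sum.inr 1), κ₂)) (u₁, (Sum.inr (Sum.inr 0), κ₁)))
        (P.1, (Sum.inl (Sum.inl P.2.1), P.2.2)) (Q.1, (Sum.inl (Sum.inl Q.2.1), Q.2.2))) *ᵥ v) := by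
    rw [hW, hB₁, hB₂, ← field_add, jet22_field_quadForm τ hτ, jet22_field_quadForm τ hτ, jet22_field_quadForm τ hτ,
      quadForm_hess22_polar_single, quadForm_emb₀_emb₀, quadForm_emb₀_emb₀]
    simp only [one_mul, Matrix.of_apply]
  -- (o') the reflected `(2,2)` block, pulled back to `v`
  have m0' : jet22 ℝ τ e (field t (pullv σ e α v))
        (bondLetter (rsite σ e α κ₁ u₁) κ₁ (sgn α κ₁ • Y₁) + bondLetter (rsite σ e α κ₂ u₂) κ₂ (sgn α κ₂ • Y₂))
      - jet22 ℝ τ e (field t (pullv σ e α v)) (bondLetter (rsite σ e α κ₁ u₁) κ₁ (sgn α κ₁ • Y₁))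
      - jet22 ℝ τ e (field t (pullv σ e α v)) (bondLetter (rsite σ e α κ₂ u₂) κ₂ (sgn α κ₂ • Y₂)) =
      sgn α κ₁ * sgn α κ₂ * (v ⬝ᵥ ((Matrix.of fun P Q : Λ × (C × D) => sgn α P.2.2 * sgn α Q.2.2 *
        (wilsonVertex₂ τ T e (rsite σ e α κ₁ u₁, (Sum.inr (Sum.inr 0), κ₁)) (rsite σ e α κ₂ u₂, (Sum.inr (Sum.inr 1), κ₂))
          + wilsonVertex₂ τ T e (rsite σ e α κ₂ u₂, (Sum.inr (Sum.inr 1), κ₂)) (rsite σ e α κ₁ u₁, (Sum.inr (Sum.inr 0), κ₁)))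
        (rsite σ e α P.2.2 P.1, (Sum.inl (Sum.inl P.2.1), P.2.2)) (rsite σ e α Q.2.2 Q.1, (Sum.inl (Sum.inl Q.2.1), Q.2.2))) *ᵥ v)) := by
    rw [hW', hB₁', hB₂', ← field_add, jet22_field_quadForm τ hτ, jet22_field_quadForm τ hτ, jet22_field_quadForm τ hτ,
      quadForm_hess22_polar_single, quadForm_emb₀_emb₀, quadForm_emb₀_emb₀, pullv_quadForm hσ h₂]
    simp only [Matrix.of_apply]
  -- (ii) the `(2,1)` bracket: the one-bond vertices between the fluctuation and the two conjugated cuts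
  have m1 : (jet21 ℝ τ e (field t v + (reflDir₁ (field t v) (bondLetter u₁ κ₁ Y₁) α + reflDir₁ (field t v) (bondLetter u₂ κ₂ Y₂) α))
        (bondLetter u₁ κ₁ Y₁)
      + jet21 ℝ τ e (field t v + (reflDir₁ (field t v) (bondLetter u₁ κ₁ Y₁) α + reflDir₁ (field t v) (bondLetter u₂ κ₂ Y₂) α))
        (bondLetter u₂ κ₂ Y₂)
      - jet21 ℝ τ e (reflDir₁ (field t v) (bondLetter u₁ κ₁ Y₁) α + reflDir₁ (field t v) (bondLetter u₂ κ₂ Y₂) α) (bondLetter u₁ κ₁ Y₁)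
      - jet21 ℝ τ e (reflDir₁ (field t v) (bondLetter u₁ κ₁ Y₁) α + reflDir₁ (field t v) (bondLetter u₂ κ₂ Y₂) α) (bondLetter u₂ κ₂ Y₂))
      - (jet21 ℝ τ e (field t v + reflDir₁ (field t v) (bondLetter u₁ κ₁ Y₁) α) (bondLetter u₁ κ₁ Y₁)
        - jet21 ℝ τ e (reflDir₁ (field t v) (bondLetter u₁ κ₁ Y₁) α) (bondLetter u₁ κ₁ Y₁))
      - (jet21 ℝ τ e (field t v + reflDir₁ (field t v) (bondLetter u₂ κ₂ Y₂) α) (bondLetter u₂ κ₂ Y₂)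
        - jet21 ℝ τ e (reflDir₁ (field t v) (bondLetter u₂ κ₂ Y₂) α) (bondLetter u₂ κ₂ Y₂)) =
      -(v ⬝ᵥ ((Matrix.of fun P Q : Λ × (C × D) => if Q.1 = u₂ ∧ Q.2.2 = α ∧ α = κ₂ then
            wilsonVertex₁ e u₁ κ₁ (adM τ T Y₁) (P.1, (Sum.inl (Sum.inl P.2.1), P.2.2)) (Q.1, (Sum.inl (Sum.inr (Sum.inl Q.2.1)), Q.2.2))
            else 0) *ᵥ v)
        + v ⬝ᵥ ((Matrix.of fun P Q : Λ × (C × D) => if P.1 = u₂ ∧ P.2.2 = α ∧ α = κ₂ then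
            wilsonVertex₁ e u₁ κ₁ (adM τ T Y₁) (P.1, (Sum.inl (Sum.inr (Sum.inl P.2.1)), P.2.2)) (Q.1, (Sum.inl (Sum.inl Q.2.1), Q.2.2))
            else 0) *ᵥ v)
        + v ⬝ᵥ ((Matrix.of fun P Q : Λ × (C × D) => if Q.1 = u₁ ∧ Q.2.2 = α ∧ α = κ₁ then
            wilsonVertex₁ e u₂ κ₂ (adM τ T Y₂) (P.1, (Sum.inl (Sum.inl P.2.1), P.2.2)) (Q.1, (Sum.inr (Sum.inl (Sum.inl Q.2.1)), Q.2.2))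
            else 0) *ᵥ v)
        + v ⬝ᵥ ((Matrix.of fun P Q : Λ × (C × D) => if P.1 = u₁ ∧ P.2.2 = α ∧ α = κ₁ then
            wilsonVertex₁ e u₂ κ₂ (adM τ T Y₂) (P.1, (Sum.inr (Sum.inl (Sum.inl P.2.1)), P.2.2)) (Q.1, (Sum.inl (Sum.inl Q.2.1), Q.2.2))
            else 0) *ᵥ v)) := by
    rw [reflDir₁_bondLetter, reflDir₁_bondLetter, hE₁, hE₂, hW, ← field_add, ← field_add, ← field_add, ← field_add]
    simp only [jet21_field_eq_neg_quadForm τ hτ, wilsonVertexOp_bondLetter, Matrix.mulVec_add, dotProduct_add, add_dotProduct,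
      quadForm_emb₀_emb₀, quadForm_emb₀_emb₁, quadForm_emb₁_emb₀, Matrix.of_apply, dotProduct_mulVec_cut, cut_dotProduct_mulVec]
    ring
  -- the polarised reflection law, evaluated
  have H := jet22_pull_polar τ hτ hσ h₁ h₂ (field t v) (bondLetter u₁ κ₁ Y₁) (bondLetter u₂ κ₂ Y₂)
  rw [m1, m0, pull_field, pull_bondLetter hσ h₂, pull_bondLetter hσ h₂, m0', reflDir₁_bondLetter, reflDir₁_bondLetter,
    reflDir₂_polar_bondLetter, kin_field_bondLetter, kin_bondLetter_bondLetter, kin₃_quadForm, kin₄_quadForm] at H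
  simp only [Matrix.sub_mulVec, Matrix.add_mulVec, Matrix.smul_mulVec, dotProduct_sub, dotProduct_add, dotProduct_smul,
    smul_eq_mul]
  linear_combination H

/-- **THE POLARISED `(2,2)`-JET REFLECTION LAW, ENTRYWISE WITH COLOUR.**  With the data of `jet22_pull_quadForm` and all legs
`P = (x,(a,μ))`, `Q = (z,(b,ν))` of the leg space `Λ × (C × D)`: `N P Q + N Q P = 0` for the matrix `N` of that law (its blocks written
out entrywise: reflected two-bond vertex with signs and reflected sites; two-bond vertex; the four cut one-bond vertices; the two
contact traces against `curlCurl`). [folklore] -/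
theorem jet22_pull_entry_colour (τ : 𝔸 →ₗ[ℝ] ℝ) (hτ : ∀ a b : 𝔸, τ (a * b) = τ (b * a)) (hσ : Function.Involutive σ)
    (h₁ : ∀ x κ, κ ≠ α → σ (x + e κ) = σ x + e κ) (h₂ : ∀ x, σ (x + e α) = σ x - e α) (t : C → 𝔸) (Y₁ Y₂ : 𝔸)
    (u₁ u₂ : Λ) (κ₁ κ₂ : D) (P Q : Λ × (C × D)) :
    let T : (C ⊕ (C ⊕ Fin 0)) ⊕ ((C ⊕ (C ⊕ Fin 0)) ⊕ Fin 2) → 𝔸 := rotFam (rotFam t Y₂ ![]) Y₁ ![Y₁, Y₂]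
    let N : Matrix (Λ × (C × D)) (Λ × (C × D)) ℝ := Matrix.of fun P Q =>
      4 * (sgn α κ₁ * sgn α κ₂) * (sgn α P.2.2 * sgn α Q.2.2 *
          (wilsonVertex₂ τ T e (rsite σ e α κ₁ u₁, (Sum.inr (Sum.inr 0), κ₁)) (rsite σ e α κ₂ u₂, (Sum.inr (Sum.inr 1), κ₂))
            + wilsonVertex₂ τ T e (rsite σ e α κ₂ u₂, (Sum.inr (Sum.inr 1), κ₂)) (rsite σ e α κ₁ u₁, (Sum.inr (Sum.inr 0), κ₁)))
          (rsite σ e α P.2.2 P.1, (Sum.inl (Sum.inl P.2.1), P.2.2)) (rsite σ e α Q.2.2 Q.1, (Sum.inl (Sum.inl Q.2.1), Q.2.2)))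
      - 4 * (wilsonVertex₂ τ T e (u₁, (Sum.inr (Sum.inr 0), κ₁)) (u₂, (Sum.inr (Sum.inr 1), κ₂))
          + wilsonVertex₂ τ T e (u₂, (Sum.inr (Sum.inr 1), κ₂)) (u₁, (Sum.inr (Sum.inr 0), κ₁)))
          (P.1, (Sum.inl (Sum.inl P.2.1), P.2.2)) (Q.1, (Sum.inl (Sum.inl Q.2.1), Q.2.2))
      + 4 * ((if Q.1 = u₂ ∧ Q.2.2 = α ∧ α = κ₂ then
            wilsonVertex₁ e u₁ κ₁ (adM τ T Y₁) (P.1, (Sum.inl (Sum.inl P.2.1), P.2.2)) (Q.1, (Sum.inl (Sum.inr (Sum.inl Q.2.1)), Q.2.2))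
            else 0)
          + (if P.1 = u₂ ∧ P.2.2 = α ∧ α = κ₂ then
            wilsonVertex₁ e u₁ κ₁ (adM τ T Y₁) (P.1, (Sum.inl (Sum.inr (Sum.inl P.2.1)), P.2.2)) (Q.1, (Sum.inl (Sum.inl Q.2.1), Q.2.2))
            else 0)
          + (if Q.1 = u₁ ∧ Q.2.2 = α ∧ α = κ₁ then
            wilsonVertex₁ e u₂ κ₂ (adM τ T Y₂) (P.1, (Sum.inl (Sum.inl P.2.1), P.2.2)) (Q.1, (Sum.inr (Sum.inl (Sum.inl Q.2.1)), Q.2.2))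
            else 0)
          + (if P.1 = u₁ ∧ P.2.2 = α ∧ α = κ₁ then
            wilsonVertex₁ e u₂ κ₂ (adM τ T Y₂) (P.1, (Sum.inr (Sum.inl (Sum.inl P.2.1)), P.2.2)) (Q.1, (Sum.inl (Sum.inl Q.2.1), Q.2.2))
            else 0))
      - 2 * (if Q.1 = u₁ ∧ Q.2.2 = α ∧ (u₁ = u₂ ∧ α = κ₁ ∧ α = κ₂) then
          τ (t P.2.1 * (Y₁ * (Y₂ * t Q.2.1 - t Q.2.1 * Y₂) - (Y₂ * t Q.2.1 - t Q.2.1 * Y₂) * Y₁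
            + (Y₂ * (Y₁ * t Q.2.1 - t Q.2.1 * Y₁) - (Y₁ * t Q.2.1 - t Q.2.1 * Y₁) * Y₂))) * curlCurl e (P.1, P.2.2) (u₁, α)
          else 0)
      - 4 * (if (P.1 = u₁ ∧ P.2.2 = α) ∧ (Q.1 = u₂ ∧ Q.2.2 = α) ∧ (α = κ₁ ∧ α = κ₂) then
          τ ((Y₁ * t P.2.1 - t P.2.1 * Y₁) * (Y₂ * t Q.2.1 - t Q.2.1 * Y₂)) * curlCurl e (u₁, α) (u₂, α) else 0)
    N P Q + N Q P = 0 := by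
  intro T N
  have key := entry_add_entry_eq_zero_of_quadForm _ (fun v => jet22_pull_quadForm τ hτ hσ h₁ h₂ t Y₁ Y₂ u₁ u₂ κ₁ κ₂ T rfl v) P Q
  simp only [Matrix.sub_apply, Matrix.add_apply, Matrix.smul_apply, Matrix.of_apply, smul_eq_mul] at key
  simp only [N, Matrix.of_apply, Matrix.add_apply]
  linear_combination key

end Main

end Summit.QuantumFields.BalabanUV.Beta.WilsonJetReflection2Entry
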